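import Summits.Ventures.CertifiedArithmetic.LowPrec.SignificandErrorValue
import Summits.Ventures.CertifiedArithmetic.LowPrec.JRBridge
import Summits.Ventures.CertifiedArithmetic.LowPrec.ErrorTables

/-!
# Round-to-nearest-even into `bfloat16` on the quarter grid, by small-integer arithmetic

HONEST FRAMING (venture CertifiedArithmetic / cell `pub-lowprec`, seat gemm, gen 6): certified error
envelopes and provably optimal rounding/accumulation schemes for low-precision formats under stated
cost models; every table by two implementations; no hardware or vendor claims.

Purpose: the finite certificates of `gemm.tex` §Regimes (reachable accumulator graphs of the E2M1²
products into `bfloat16`) live on the grid `¼ℤ` below `2^16`; checking their ~10^5 edges in the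
kernel through the generic `roundNE` (140-bit scaled magnitudes, `shiftAux` with fuel 253) costs
~25 ms per rounding, through the integer function of this file ~1 ms.  `rneQuarter K` is RNE to
8 significant bits of the integer `K` (a magnitude in quarter units: `quarterShift` finds the binade,
`rneShiftNat n k` rounds `n / 2^k` to the nearest integer, ties to even), and
`toRat_roundNE_BFloat16_quarter` proves `fl_bf16(K/4) = rneQuarter K / 4` for `|K| < 2^32` from the
closed form `Format.rneGrid_of_pattern` (SignificandError.lean) and the exactness of 8-bit integers.
Nothing here is specific to the gemm certificates; File `GemmThetaE2M1Data.lean` is the first user.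
-/

namespace Literature.ComputerArithmetic.FloatingPoint

namespace MiniFloat

open Format

/-! ### Integer round-to-nearest-even of `n / 2^k` -/

/-- `rneShiftNat n k` = round-half-even of `n / 2^k`, by the Euclidean division of `n` by `2^k`.
[cite: IEEE7542019, §4.3.1] -/
def rneShiftNat (n k : ℕ) : ℕ :=
  if 2 * (n % 2 ^ k) < 2 ^ k then n / 2 ^ k
  else if 2 ^ k < 2 * (n % 2 ^ k) then n / 2 ^ k + 1
  else if n / 2 ^ k % 2 = 0 then n / 2 ^ k else n / 2 ^ k + 1

/-- `rneShiftNat` computes `rneInt (n / 2^k)`. [folklore] -/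
theorem rneInt_natCast_div_two_pow (n k : ℕ) :
    rneInt ((n : ℚ) / 2 ^ k) = (rneShiftNat n k : ℤ) := by
  have hD : (0 : ℚ) < 2 ^ k := by positivity
  have hfl := floor_natCast_div_two_pow n k
  have hfrac : (n : ℚ) / 2 ^ k - ((⌊(n : ℚ) / 2 ^ k⌋ : ℤ) : ℚ) = ((n % 2 ^ k : ℕ) : ℚ) / 2 ^ k := by
    rw [hfl, Int.cast_natCast, natCast_div_two_pow n k]; ring
  have hlt : ((n % 2 ^ k : ℕ) : ℚ) / 2 ^ k < 1 / 2 ↔ 2 * (n % 2 ^ k) < 2 ^ k := by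
    rw [div_lt_iff₀ hD]
    constructor
    · intro h
      have h' : ((2 * (n % 2 ^ k) : ℕ) : ℚ) < ((2 ^ k : ℕ) : ℚ) := by push_cast; linarith
      exact_mod_cast h'
    · intro h
      have h' : ((2 * (n % 2 ^ k) : ℕ) : ℚ) < ((2 ^ k : ℕ) : ℚ) := by exact_mod_cast h
      push_cast at h'; linarith
  have hgt : 1 / 2 < ((n % 2 ^ k : ℕ) : ℚ) / 2 ^ k ↔ 2 ^ k < 2 * (n % 2 ^ k) := by
    rw [lt_div_iff₀ hD]
    constructor
    · intro h
      have h' : ((2 ^ k : ℕ) : ℚ) < ((2 * (n % 2 ^ k) : ℕ) : ℚ) := by push_cast; linarith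
      exact_mod_cast h'
    · intro h
      have h' : ((2 ^ k : ℕ) : ℚ) < ((2 * (n % 2 ^ k) : ℕ) : ℚ) := by exact_mod_cast h
      push_cast at h'; linarith
  have hpar : (2 : ℤ) ∣ ((n / 2 ^ k : ℕ) : ℤ) ↔ n / 2 ^ k % 2 = 0 := by omega
  unfold rneInt rneShiftNat
  rw [hfrac, hfl]
  simp only [hlt, hgt, hpar]
  split_ifs <;> push_cast <;> ring

/-! ### The binade on the quarter grid -/

/-- `quarterShift n fuel`: the number of halvings (at most `fuel`) bringing `n` below `2^8`, i.e.
`bitlength n - 8` for `2^8 ≤ n < 2^(8 + fuel)`.  Structural recursion on `fuel`. [folklore] -/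
def quarterShift : ℕ → ℕ → ℕ
  | _, 0 => 0
  | n, fuel + 1 => if n < 256 then 0 else quarterShift (n / 2) fuel + 1

/-- `quarterShift` finds the binade: `2^(7+k) ≤ n < 2^(7+k+1)` for `k = quarterShift n fuel`,
whenever `2^8 ≤ n < 2^(8+fuel)`. [folklore] -/
theorem quarterShift_spec : ∀ (fuel n : ℕ), 256 ≤ n → n < 2 ^ (8 + fuel) →
    2 ^ (7 + quarterShift n fuel) ≤ n ∧ n < 2 ^ (7 + quarterShift n fuel + 1)
  | 0, n, h1, h2 => by norm_num at h2; omega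
  | fuel + 1, n, h1, h2 => by
      have hn : ¬ n < 256 := not_lt.mpr h1
      simp only [quarterShift, if_neg hn]
      by_cases h : n / 2 < 256
      · have h0 : quarterShift (n / 2) fuel = 0 := by
          cases fuel <;> simp [quarterShift, h]
        rw [h0]; norm_num; omega
      · have h2' : n / 2 < 2 ^ (8 + fuel) := by
          rw [show 8 + (fuel + 1) = (8 + fuel) + 1 by omega, pow_succ] at h2; omega
        obtain ⟨hlo, hhi⟩ := quarterShift_spec fuel (n / 2) (not_lt.mp h) h2'
        constructor
        · rw [show 7 + (quarterShift (n / 2) fuel + 1) = (7 + quarterShift (n / 2) fuel) + 1 by omega,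
            pow_succ]; omega
        · rw [show 7 + (quarterShift (n / 2) fuel + 1) + 1 = (7 + quarterShift (n / 2) fuel + 1) + 1
            by omega, pow_succ]; omega

/-! ### RNE to 8 significant bits in quarter units -/

/-- Magnitude part: `n < 2^8` is exact, else round the pattern `n` to 8 bits in its binade.
[cite: IEEE7542019, §4.3.1] -/
def rneQuarterMag (n : ℕ) : ℕ :=
  if n < 256 then n else rneShiftNat n (quarterShift n 24) * 2 ^ quarterShift n 24

/-- `rneQuarter K`: round-to-nearest-even to 8 significant bits of the integer `K` (sign kept).
With `K` read in quarter units this is `4 · fl_bf16(K/4)` (`toRat_roundNE_BFloat16_quarter`).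
[cite: IEEE7542019, §4.3.1] -/
def rneQuarter (K : ℤ) : ℤ :=
  if K < 0 then -((rneQuarterMag K.natAbs : ℕ) : ℤ) else ((rneQuarterMag K.natAbs : ℕ) : ℤ)

/-- `bfloat16` has 7 trailing significand bits. [cite: BlanchardHighamLopezMaryPranesh2020, Table 1.1] -/
theorem BFloat16_manBits : Format.BFloat16.manBits = 7 := rfl

/-- `bfloat16` has quantum exponent `-133`. [cite: BlanchardHighamLopezMaryPranesh2020, Table 1.1] -/
theorem BFloat16_qexp : Format.BFloat16.qexp = -133 := by decide

/-- Integers below `256` in magnitude, read in quarter units, are `bfloat16` values. [folklore] -/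
theorem exists_toRat_eq_quarter {K : ℤ} (hK : K.natAbs < 256) :
    ∃ y : MiniFloat Format.BFloat16, y.toRat = (K : ℚ) / 4 := by
  refine exists_toRat_eq_of_isFloat ⟨K, -2, ?_, by rw [BFloat16_qexp]; norm_num, ?_⟩ ?_
  · rw [BFloat16_manBits]; norm_num; rw [← Int.natCast_natAbs]; exact_mod_cast hK
  · rw [zpow_neg, zpow_ofNat]; ring
  · rw [BFloat16_maxRat.1, abs_div, abs_of_pos (by norm_num : (0 : ℚ) < 4), ← Int.cast_abs,
      ← Nat.cast_natAbs, div_le_iff₀ (by norm_num : (0 : ℚ) < 4)]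
    have : ((K.natAbs : ℕ) : ℚ) < 256 := by exact_mod_cast hK
    linarith

/-- THE BRIDGE: on the quarter grid below `2^30`, `fl_bf16(K/4) = rneQuarter K / 4`.
[folklore; closed form `Format.rneGrid_of_pattern`] -/
theorem toRat_roundNE_BFloat16_quarter (K : ℤ) (hK : K.natAbs < 2 ^ 32) :
    (roundNE Format.BFloat16 ((K : ℚ) / 4)).toRat = (rneQuarter K : ℚ) / 4 := by
  have habs : |(K : ℚ) / 4| = (K.natAbs : ℚ) / 4 := by
    rw [abs_div, abs_of_pos (by norm_num : (0 : ℚ) < 4), Nat.cast_natAbs, Int.cast_abs]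
  have hsgn : (K : ℚ) / 4 < 0 ↔ K < 0 := by
    rw [div_lt_iff₀ (by norm_num : (0 : ℚ) < 4), zero_mul]; norm_cast
  by_cases hn : K.natAbs < 256
  · -- exact branch
    rw [toRat_roundNE_of_exists (exists_toRat_eq_quarter hn)]
    unfold rneQuarter rneQuarterMag
    rw [if_pos hn]
    have : (if K < 0 then -((K.natAbs : ℕ) : ℤ) else ((K.natAbs : ℕ) : ℤ)) = K := by
      split_ifs with h <;> omega
    rw [this]
  · -- pattern branch
    set k := quarterShift K.natAbs 24 with hk
    obtain ⟨hlo, hhi⟩ := quarterShift_spec 24 K.natAbs (not_lt.mp hn) hK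
    have hq2 : Format.BFloat16.quantum = 1 / 2 ^ 133 := BFloat16_maxRat.2
    have hx : |(K : ℚ) / 4| = (K.natAbs : ℚ) * 2 ^ (131 + k) / 2 ^ k * Format.BFloat16.quantum := by
      rw [habs, hq2, pow_add]; field_simp; ring
    have hmax : |(K : ℚ) / 4| ≤ Format.BFloat16.maxRat := by
      rw [habs, BFloat16_maxRat.1, div_le_iff₀ (by norm_num : (0 : ℚ) < 4)]
      have : ((K.natAbs : ℕ) : ℚ) < 2 ^ 32 := by exact_mod_cast hK
      norm_num at this ⊢; linarith
    have hlo' : 2 ^ (Format.BFloat16.manBits + k) ≤ K.natAbs := by rw [BFloat16_manBits]; exact hlo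
    have hhi' : K.natAbs < 2 ^ (Format.BFloat16.manBits + k + 1) := by rw [BFloat16_manBits]; exact hhi
    have hgrid := Format.rneGrid_of_pattern hlo' hhi' (pattern_le_maxScaled hx hmax)
    rw [rneInt_natCast_div_two_pow, Int.cast_natCast] at hgrid
    rw [toRat_roundNE, scaledInput_of_pattern hx]
    unfold rneQuarter rneQuarterMag
    rw [if_neg hn, ← hk]
    simp only [hsgn]
    split_ifs with hneg
    · rw [neg_mul, hgrid, hq2]; push_cast; rw [pow_add]; field_simp; ring
    · rw [hgrid, hq2]; push_cast; rw [pow_add]; field_simp; ring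

end MiniFloat

end Literature.ComputerArithmetic.FloatingPoint
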